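import Literature.Topology.FourManifolds.CurveFamilyIsotopy
import Literature.Topology.FourManifolds.IsotopyExtensionRel
import Literature.Topology.FourManifolds.KnotArcLift
import HarnessLib

/-!
# Ambient isotopies from smooth families of modifications of a knot, with support control

Topic `Literature/Topology/FourManifolds`. Infrastructure for the fact seat
`provefact-Literature.Topology.FourManifolds.BandData.exists_ambientIsotopy_of_band_eq_of_isRegular`
(`BandSumIsotopyRegular.lean`: two band sums along the same regular band are related by an ambient
isotopy supported near the band). Everything here is proved; no named facts are introduced.

Let `K : 𝕊¹ ↪ 𝕊³` be a knot with unit-period curve `K.curve = (↑) ∘ K ∘ circlePt`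
(`KnotFraming.lean`), and let `G u : ℝ → ℝ⁴`, `u ∈ ℝ`, be a jointly `C^∞` family of *piece
functions* which agree with `K.curve` off a closed set `S` of parameters contained in the interior
`[a + ε, a + 1 - ε]` of a fundamental domain, start at `G 0 = K.curve`, and for `u ∈ [0, 1]` are
unit, regular and injective on `S` and avoid the old curve off `S` (`Knot.IsModification`). Then
the loops `periodise a (G u)` (`CurveFamilyIsotopy.lean`) are simple regular loops, their knots form
a smooth isotopy of embeddings `𝕊¹ → 𝕊³` **starting at `K` itself**
(`Knot.IsModification.isotopy`), and the isotopy extension theorem relative to a closed set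
(`exists_ambientIsotopy_comp_eq_rel`, `IsotopyExtensionRel.lean`; Hirsch (1976), Ch. 8 §1,
Thm. 1.3, with support in a neighbourhood of the track of the moving part) covers it by an ambient
isotopy `Ψ` of `𝕊³` which is the **identity off any open set `O` containing the moving points
`G u s`, `s ∈ S`, `u ∈ [0, 1]`**, with `Ψ₁ ∘ K ∘ circlePt = periodise a (G 1)`
(`Knot.IsModification.exists_ambientIsotopy`).

This is the form of the isotopy extension theorem consumed by the band-sum assembly: an isotopy of
a knot which moves only two arcs of it, through a prescribed neighbourhood of a surface, extends to
an ambient isotopy stationary off that neighbourhood.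

## References

* M. W. Hirsch, *Differential Topology*, GTM 33 (1976), Ch. 8 §1, Thm. 1.3 (isotopy extension with
  compact support in a neighbourhood of the track). [HirschDT1976]
* J. Milnor, *Lectures on the h-cobordism theorem* (1965), Thm. 5.8. [MilnorHCobordism1965]

## Design notes

* The family parameter is clamped into `[0, 1]` by `Real.smoothTransition`, so that hypotheses are
  only needed for `u ∈ [0, 1]` while `SmoothIsotopy` asks for embeddings at every real time.
* Local notation `𝔼 n`, `𝕊 n` follows the directory pattern. Nothing here uses `sorry`.
-/

open scoped Manifold ContDiff Topology Real
open Function Set Metric Filter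

noncomputable section

namespace Literature.Topology.FourManifolds

/-- Local notation: `𝔼 n` is the model Euclidean space `EuclideanSpace ℝ (Fin n)`. -/
local notation "𝔼 " n:arg => EuclideanSpace ℝ (Fin n)

/-- Local notation: `𝕊 n` is the unit sphere in `EuclideanSpace ℝ (Fin (n + 1))`. -/
local notation "𝕊 " n:arg => (Metric.sphere (0 : EuclideanSpace ℝ (Fin (n + 1))) 1)

attribute [local instance] fact_finrank_euclideanSpace_two fact_finrank_euclideanSpace_four

/-! ## Periodisation of periodic functions; the curve of a knot as a regular loop -/

section Periodic

variable {X : Type*}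

/-- The periodisation of a `1`-periodic function is the function itself. [folklore] -/
theorem periodise_eq_of_periodic (a : ℝ) {F : ℝ → X} (hF : Periodic F 1) : periodise a F = F := by
  funext t
  obtain ⟨n, hn⟩ := exists_toIcoMod_one_eq a t
  rw [periodise, hn]
  simpa using hF.sub_int_mul_eq n (x := t)

end Periodic

namespace Knot

variable (K : Knot)

/-- The unit-period curve of a knot is a regular loop of period one. [folklore] -/
theorem isRegularLoop_curve : IsRegularLoop (Knot.curve K) where
  contDiff := K.contDiff_curve
  periodic := K.periodic_curve
  norm_eq_one := K.norm_curve
  deriv_ne_zero := K.deriv_curve_ne_zero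

/-- The unit-period curve of a knot is injective on every fundamental domain `[a, a + 1)`.
[folklore] -/
theorem injOn_curve_Ico (a : ℝ) : InjOn (Knot.curve K) (Ico a (a + 1)) := by
  intro s hs t ht hst
  obtain ⟨m, hm⟩ := K.curve_eq_curve_iff.1 hst
  have h1 : (m : ℝ) < 1 := by linarith [hs.2, ht.1]
  have h2 : (-1 : ℝ) < m := by linarith [hs.1, ht.2]
  have h1' : m < 1 := by exact_mod_cast h1
  have h2' : -1 < m := by exact_mod_cast h2
  obtain rfl : m = 0 := by omega
  simpa using hm

/-- `K (circlePoint θ)` read in `ℝ⁴` is the unit-period curve at `θ / 2π`. [folklore] -/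
theorem coe_apply_circlePoint' (θ : ℝ) :
    ((K (circlePoint θ) : 𝕊 3) : 𝔼 4) = Knot.curve K ((2 * π)⁻¹ * θ) := by
  rw [Knot.curve_apply, circlePt_eq_circlePoint, mul_inv_cancel_left₀ (by positivity : (2 * π : ℝ) ≠ 0)]

/-- **A smooth family of modifications of a knot on a parameter set `S`.** `G u : ℝ → ℝ⁴`
(`u ∈ ℝ`) is a jointly `C^∞` family of piece functions which agree with the unit-period curve of
`K` off the closed set `S ⊆ [a + ε, a + 1 - ε]`, with `G 0 = K.curve`, and which for `u ∈ [0, 1]`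
are unit, regular and injective on `S` and avoid the old curve off `S` there. [folklore] -/
structure IsModification (a ε : ℝ) (G : ℝ → ℝ → 𝔼 4) (S : Set ℝ) : Prop where
  /-- The margin is positive. -/
  ε_pos : 0 < ε
  /-- The family is jointly smooth. -/
  contDiff : ContDiff ℝ ∞ (uncurry G)
  /-- The modified parameters lie in the interior of the fundamental domain `[a, a + 1)`. -/
  subset : S ⊆ Icc (a + ε) (a + 1 - ε)
  /-- The set of modified parameters is closed. -/
  isClosed : IsClosed S
  /-- Off `S` nothing is modified. -/
  eq_curve : ∀ u t, t ∉ S → G u t = Knot.curve K t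
  /-- The family starts at the curve of `K`. -/
  zero_eq : ∀ t, G 0 t = Knot.curve K t
  /-- The pieces stay on the unit sphere. -/
  norm_eq_one : ∀ u ∈ Icc (0 : ℝ) 1, ∀ t ∈ S, ‖G u t‖ = 1
  /-- The pieces are regular. -/
  deriv_ne_zero : ∀ u ∈ Icc (0 : ℝ) 1, ∀ t ∈ S, deriv (G u) t ≠ 0
  /-- The pieces are injective on `S`. -/
  injOn : ∀ u ∈ Icc (0 : ℝ) 1, InjOn (G u) S
  /-- The pieces avoid the old curve off `S`. -/
  disjoint : ∀ u ∈ Icc (0 : ℝ) 1, ∀ s ∈ S, ∀ t ∈ Ico a (a + 1), t ∉ S → G u s ≠ Knot.curve K t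

/-! ## The smooth isotopy of knots defined by a family of modifications -/

/-- The clamped family of piece functions: `u ↦ G (smoothTransition u)`. [folklore] -/
def clampFamily (G : ℝ → ℝ → 𝔼 4) (u : ℝ) : ℝ → 𝔼 4 := G (Real.smoothTransition u)

/-- The clamped family at `u = 0`. [folklore] -/
@[simp] theorem clampFamily_zero (G : ℝ → ℝ → 𝔼 4) : clampFamily G 0 = G 0 := by
  simp [clampFamily, Real.smoothTransition.zero]

/-- The clamped family at `u = 1`. [folklore] -/
@[simp] theorem clampFamily_one (G : ℝ → ℝ → 𝔼 4) : clampFamily G 1 = G 1 := by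
  simp [clampFamily, Real.smoothTransition.one]

namespace IsModification

variable {K} {a ε : ℝ} {G : ℝ → ℝ → 𝔼 4} {S : Set ℝ} (h : K.IsModification a ε G S)
include h

/-- The clamped family is jointly smooth. [folklore] -/
theorem contDiff_clampFamily : ContDiff ℝ ∞ (uncurry (clampFamily G)) :=
  h.contDiff.comp ((Real.smoothTransition.contDiff.comp contDiff_fst).prodMk contDiff_snd)

/-- The seam condition of the piece functions (they agree with the periodic `K.curve` near the
seam). [folklore] -/
theorem seam_clampFamily (u : ℝ) :
    ∀ t ∈ Ioo (a - ε) (a + ε), clampFamily G u (t + 1) = clampFamily G u t :=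
  seam_of_eqOn_compl (F := Knot.curve K) (fun t _ ↦ K.periodic_curve t) h.subset (h.eq_curve _)

/-- **The modified loops are regular loops.** [folklore] -/
theorem isRegularLoop (u : ℝ) : IsRegularLoop (periodise a (clampFamily G u)) := by
  have h₀ : IsRegularLoop (periodise a (Knot.curve K)) := by
    rw [periodise_eq_of_periodic a K.periodic_curve]; exact K.isRegularLoop_curve
  have hGu : ContDiff ℝ ∞ (clampFamily G u) :=
    h.contDiff_clampFamily.comp (contDiff_const.prodMk contDiff_id)
  exact h₀.periodise_of_eqOn_compl hGu h.ε_pos (fun t _ ↦ K.periodic_curve t) h.subset h.isClosed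
    (h.eq_curve _) (h.norm_eq_one _ (IsRegularClosedCurve.smoothTransition_mem_Icc u))
    (h.deriv_ne_zero _ (IsRegularClosedCurve.smoothTransition_mem_Icc u))

/-- **The modified loops are simple.** [folklore] -/
theorem simple (u : ℝ) :
    ∀ s t, periodise a (clampFamily G u) s = periodise a (clampFamily G u) t → ∃ m : ℤ, t - s = m :=
  periodise_simple_iff.2 (injOn_Ico_of_eqOn_compl (K.injOn_curve_Ico a) (h.eq_curve _)
    (h.injOn _ (IsRegularClosedCurve.smoothTransition_mem_Icc u)) (h.disjoint _ (IsRegularClosedCurve.smoothTransition_mem_Icc u)))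

/-- The rescaled modified loops form a jointly `C^∞` family of regular closed curves. [folklore] -/
theorem contDiff_loopRescale :
    ContDiff ℝ ∞ (uncurry fun u ↦ loopRescale (periodise a (clampFamily G u))) := by
  have h' := contDiff_periodise_family h.contDiff_clampFamily h.ε_pos h.seam_clampFamily
  exact h'.comp (contDiff_fst.prodMk ((contDiff_const.mul contDiff_id).comp contDiff_snd))

/-- The knot at stage `u` of a family of modifications. [folklore] -/
def knotAt (u : ℝ) : Knot := (h.isRegularLoop u).toKnot (h.simple u)

/-- The knot at stage `u` through `circlePt t` is the modified loop at `t`, in `ℝ⁴`. [folklore] -/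
theorem coe_knotAt_circlePt (u t : ℝ) :
    ((h.knotAt u (circlePt t) : 𝕊 3) : 𝔼 4) = periodise a (clampFamily G u) t :=
  (h.isRegularLoop u).coe_toKnot_circlePt (h.simple u) t

/-- The knot at stage `0` is `K`. [folklore] -/
theorem knotAt_zero : h.knotAt 0 = K := by
  apply SphereEmbedding.ext
  funext x
  obtain ⟨t, rfl⟩ : ∃ t, circlePt t = x := ⟨angA x, circlePt_angA x⟩
  apply Subtype.ext
  rw [SphereEmbedding.toFun_eq_coe, SphereEmbedding.toFun_eq_coe, coe_knotAt_circlePt, clampFamily_zero,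
    show G 0 = Knot.curve K from funext h.zero_eq, periodise_eq_of_periodic a K.periodic_curve,
    Knot.curve_apply]

/-- **The smooth isotopy of knots defined by a family of modifications, starting at `K`.** Its
stage `u` is the map `𝕊¹ → 𝕊³` induced by the regular closed curve
`loopRescale (periodise a (G (smoothTransition u)))`. [folklore] -/
def isotopy : SmoothIsotopy (𝓡 1) (𝓡 3) ⇑K ⇑(h.knotAt 1) where
  toFun u := ⇑(h.knotAt u)
  contMDiff := IsRegularClosedCurve.contMDiff_toSphereMap_family h.contDiff_loopRescale
    fun u ↦ (h.isRegularLoop u).isRegularClosedCurve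
  isSmoothEmbedding u := (h.knotAt u).isSmoothEmbedding
  map_zero := by rw [h.knotAt_zero]
  map_one := rfl

/-- Stages of the isotopy. [folklore] -/
theorem isotopy_toFun (u : ℝ) : h.isotopy.toFun u = ⇑(h.knotAt u) := rfl

/-- **Off `S` (modulo the period) the isotopy is stationary.** [folklore] -/
theorem knotAt_apply_of_forall_not_mem (u : ℝ) {x : 𝕊 1} (hx : ∀ s ∈ S, circlePt s ≠ x) :
    h.knotAt u x = K x := by
  obtain ⟨t, rfl⟩ : ∃ t, circlePt t = x := ⟨angA x, circlePt_angA x⟩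
  apply Subtype.ext
  obtain ⟨n, hn⟩ := exists_toIcoMod_one_eq a t
  have hτ : toIcoMod zero_lt_one a t ∉ S := fun hs ↦ hx _ hs (by
    rw [hn, show t - (n : ℝ) = t + ((-n : ℤ) : ℝ) by push_cast; ring, circlePt_add_int])
  rw [coe_knotAt_circlePt, periodise, clampFamily, h.eq_curve _ _ hτ, hn, Knot.curve_apply,
    show t - (n : ℝ) = t + ((-n : ℤ) : ℝ) by push_cast; ring, circlePt_add_int]

/-- **On `S` the isotopy is the piece function.** [folklore] -/
theorem coe_knotAt_circlePt_of_mem (u : ℝ) {s : ℝ} (hs : s ∈ S) :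
    ((h.knotAt u (circlePt s) : 𝕊 3) : 𝔼 4) = G (Real.smoothTransition u) s := by
  rw [coe_knotAt_circlePt, periodise_eq_self a _ (Icc_subset_Ico_fundamental h.ε_pos (h.subset hs))]
  rfl

/-- **Ambient isotopy of a family of modifications, with support.** If the open set `O ⊆ 𝕊³`
contains all the moving points `G u s` (`u ∈ [0, 1]`, `s ∈ S`), there is an ambient isotopy `Ψ`
of `𝕊³`, equal to the identity off `O` at all times, with `Ψ_u ∘ K` the knot of the stage-`u`
modified loop for `u ∈ [0, 1]`; in particular `Ψ₁ ∘ K ∘ circlePt = periodise a (G 1)` in `ℝ⁴`.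
Isotopy extension relative to the closed set `𝕊³ ∖ O` (`exists_ambientIsotopy_comp_eq_rel`), the
stationary part being the parameters off `S`. Hirsch (1976), Ch. 8 §1, Thm. 1.3.
[cite: HirschDT1976, Ch. 8 §1, Thm. 1.3] -/
theorem exists_ambientIsotopy {O : Set (𝕊 3)} (hO : IsOpen O)
    (hGO : ∀ y : 𝕊 3, y ∉ O → ∀ u ∈ Icc (0 : ℝ) 1, ∀ s ∈ S, (y : 𝔼 4) ≠ G u s) :
    ∃ Ψ : AmbientIsotopy (𝓡 3) (𝕊 3), (∀ t (y : 𝕊 3), y ∉ O → Ψ.toFun t y = y) ∧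
      (∀ u ∈ Icc (0 : ℝ) 1, Ψ.toFun u ∘ ⇑K = ⇑(h.knotAt u)) ∧
      ∀ t, ((Ψ.toFun 1 (K (circlePt t)) : 𝕊 3) : 𝔼 4) = periodise a (G 1) t := by
  have hSc : IsCompact S := isCompact_Icc.of_isClosed_subset h.isClosed h.subset
  set W : Set (𝕊 1) := (circlePt '' S)ᶜ with hW
  have hWo : IsOpen W := (hSc.image continuous_circlePt).isClosed.isOpen_compl
  have hstat : ∀ t, ∀ x ∈ W, h.isotopy.toFun t x = K x := fun t x hx ↦
    h.knotAt_apply_of_forall_not_mem t fun s hs he ↦ hx ⟨s, hs, he⟩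
  have hZW : ∀ t x, h.isotopy.toFun t x ∈ Oᶜ → x ∈ W := by
    intro t x hx
    by_contra hxW
    simp only [hW, mem_compl_iff, not_not] at hxW
    obtain ⟨s, hs, rfl⟩ := hxW
    refine hGO _ hx _ (IsRegularClosedCurve.smoothTransition_mem_Icc t) s hs ?_
    rw [isotopy_toFun, h.coe_knotAt_circlePt_of_mem t hs]
  obtain ⟨Ψ, hΨ, hfix⟩ := exists_ambientIsotopy_comp_eq_rel h.isotopy hWo hstat hO.isClosed_compl hZW
  refine ⟨Ψ, fun t y hy ↦ hfix t y hy, fun u hu ↦ hΨ u hu, fun t ↦ ?_⟩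
  have h1 := congrFun (hΨ 1 ⟨zero_le_one, le_rfl⟩) (circlePt t)
  rw [comp_apply, isotopy_toFun] at h1
  rw [h1, coe_knotAt_circlePt, clampFamily_one]

end IsModification

end Knot

end Literature.Topology.FourManifolds
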